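import Summits.QuantumFields.BalabanUV.Beta.EriceRemainderEnclosureHistoryAutonomyComparisonAgeCompositionTwoYoungestFree
import Summits.QuantumFields.BalabanUV.Beta.EriceRemainderEnclosureHistoryAutonomyComparisonAgeCompositionYoungSecondTower10

/-!
# EriceRemainderEnclosureHistoryAutonomyComparisonAgeCompositionRatioTenThroughout — (E110h) route (N), first order: RATIO TEN THROUGHOUT — EVERY PROFILE WHOSE CONSECUTIVE AGES ARE
# IN RATIO AT LEAST TEN.  The END of the tower axis of the census: **`flow_nonneg_ratio_ten`** — for EVERY youngest age `a_0 ≥ 1`, EVERY number `r` of ages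
# `a_0 < a_1 < … < a_{r−1}` (`< K`, the profile vanishing off them) with `10·a_j ≤ a_{j+1}` for every `j`, and NOTHING ELSE: `0 ≤ ε ≤ e` at every pin along every
# admissible flow, every horizon, every damping of the self-consistent class.  Cases: a lone age or an old second age `a_1 ≥ 58` — (E110e)
# `flow_nonneg_tower10_old_second` ((E109d) `a_0 = 1` ∕ (E110f) `a_0 ≥ 2`: table overshoots, young pair letter at the bottom); a young second age `a_1 ≤ 57` —
# (E110g) `flow_nonneg_young_second_tower10` (two young pair letters, the ADAPTIVE youngest overshoot, the bilinear core (E110g-a∕b∕c)).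
# HISTORY OF THE RATIO: `×58` between singletons for ages `a_0 ≥ 1` ((E95), gen 85); `×16 ∕ ×12 ∕ ×10` for census towers `{1, k₂ ≥ 58, …}` and old towers `a_0 ≥ 58`
# ((E106)–(E109), gen 90, finite-state invariant of the overshoot recursion + rate constant 3); THIS generation removes every age restriction at ratio `10`
# (young pair caps (E110b∕c), young closures (E110f), adaptive youngest overshoot (E110g)).  Below ratio 10 the two-letter recursion has no invariant
# (README g90 §6(e)); the young pair `{a_0, a_1}` at ANY ratio survives only with `a_2 ≥ 58a_1` ((E110e) `flow_nonneg_tower10_two_youngest_free`).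
# CENSUS COROLLARIES: **`flow_nonneg_four_ages_ratio_ten`** (`{k₁<k₂<k₃<k₄}`, EVERY `k₁`, each ratio `≥ 10`), **`flow_nonneg_five_ages_ratio_ten`**.

Cell `pub-balaban`, β-function sub-cell, BINDER row D4 «RemainderConst leaves for Bałaban's split» (`HOME/BINDER-OWNERS.md`; owner lineage `b2b-balaban-beta-an4`;
this file by co-owner #2 lineage `b2b-balaban-beta-d4-p2`, generation 91), β-FLOW TEAM duty (1), FREEZE (0) honoured (def-free; nothing restated).

HONEST FRAMING (page 1, verbatim and binding).  *"Discharging BetaPertH makes Bałaban's UV stability UNCONDITIONAL — a real constructive-QFT result; it is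
NOT the continuum limit and NOT the Clay problem."*  THIS FILE DISCHARGES NOTHING OF THE KIND.  Elementary real algebra ∕ real analysis about ABSTRACT
functionals on a box ]0,γ]^ℕ with displayed floors, profiles and signs, and the FIRST-ORDER renewal objects of route (N) built from them — hypotheses of a
census, not facts; the form, signs, ages and moments of Bałaban's (1.22) limit functional are NOT PRINTED ([I] p. 298; GAPS G-t4-U2-1∕-2) and NOT asserted.
Row D4 class UNCHANGED (critical-path width 0; instance 0∕1; D4 DISCHARGE NO DATE).  HONEST DEPENDENCY: continuum YM on T⁴ ⇐ BetaPertH ∧ nine spine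
estimates (0/9 proved); BetaPertH ⇐ (D1) ∧ (D4) ∧ CAP+tail; G-an2-4 gates asym, D1 and NE2/3/4.

THE POINT (README `HOME/b2b-balaban-beta-d4-p2/g91/README.md` §1).  Uses (E110e) `flow_nonneg_tower10_old_second`, (E110g) `flow_nonneg_young_second_tower10` BY NAME.
NOT CLAIMED: any ratio below 10 (first order); arbitrary dampings in `]0,1]` outside the self-consistent class; anything nonlinear; anything printed — NOT B12 Thm 2,
NOT BetaPertH, NOT continuum, NOT Clay.

WHAT IS PROVED ([folklore]; 0 `def`, 0 sorry).  §1 **`flow_nonneg_ratio_ten`**.  §2 **`flow_nonneg_four_ages_ratio_ten`**, **`flow_nonneg_five_ages_ratio_ten`**.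
-/
noncomputable section
open Finset

namespace Summit.QuantumFields.BalabanUV.Beta.EriceRemainderEnclosureHistoryAutonomyComparisonAgeCompositionRatioTenThroughout

open Literature.MathematicalPhysics.QuantumFieldTheory.Balaban1983to89
open Literature.MathematicalPhysics.QuantumFieldTheory.Balaban1983to89.T4BetaStationary
open Literature.MathematicalPhysics.QuantumFieldTheory.Balaban1983to89.T4BetaFlowWellPosed
open Summit.QuantumFields.BalabanUV.Beta.EriceRemainderEnclosureHistoryAutonomyComparisonAgeCompositionTwoYoungestFree (flow_nonneg_tower10_old_second)
open Summit.QuantumFields.BalabanUV.Beta.EriceRemainderEnclosureHistoryAutonomyComparisonAgeCompositionYoungSecondTower10 (flow_nonneg_young_second_tower10)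

variable {B : (ℕ → ℝ) → ℝ} {γ b gIR : ℝ} {L : ℕ → ℝ} {K : ℕ} {h g : ℕ → ℝ}

/-! ## §1 Ratio ten throughout -/

/-- **RATIO TEN THROUGHOUT — EVERY YOUNGEST AGE, EVERY NUMBER OF AGES, NO OTHER CONDITION.**  `B` an isotone memory with floor `b > 0` dominating the profile
`L ≥ 0`, `h` a box solution, `g` a damping of the self-consistent class `g_t(1 + F_t) ≥ 1`, the route-(N) renewal objects `KL, KA, RA`, the excess `e ≥ 0`
non-increasing, `ε` the zero-tailed solution of `ε = e − RA 1 ε`.  Ages `a_0 < a_1 < … < a_{r−1}` (`r ≥ 1`) with `1 ≤ a_0` and `10·a_j ≤ a_{j+1}` for every `j`,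
all `< K`, the profile vanishing off them.  THEN `0 ≤ ε ≤ e` at every pin. [folklore] -/
theorem flow_nonneg_ratio_ten
    (hmono : ∀ u v : ℕ → ℝ, SeqBox γ u → SeqBox γ v → (∀ j, u j ≤ v j) → B u ≤ B v)
    (hL : ∀ k, 0 ≤ L k) (hb : 0 < b) (hlo : ∀ u, SeqBox γ u → b ≤ B u) (hdom : ∀ u, SeqBox γ u → ∑ k ∈ range K, L k * u k ≤ B u)
    (hh : SeqBox γ h) (hf : MemFlow B gIR h) (hg : ∀ t, 0 < g t ∧ g t ≤ 1)
    (hgF : ∀ t, 1 ≤ g t * (1 + ∑ k ∈ range K, L k * h (t + k) ^ 3 / 2))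
    {r : ℕ} {a : ℕ → ℕ} (hr : 1 ≤ r) (ha0 : 1 ≤ a 0)
    (haR : ∀ j, j + 1 < r → 10 * a j ≤ a (j + 1)) (haK : ∀ j, j < r → a j < K)
    (hLa : ∀ l, l < K → (∀ j, j < r → l ≠ a j) → L l = 0)
    {N : ℕ} {KL : ℕ → ℕ → ℕ → ℝ}
    (hKL : ∀ k n l, KL k n l = if 0 < k ∧ k < K ∧ l < k then L k * h (n + k) ^ 3 / 2 * ∏ t ∈ Ico (n + 1 + l) (n + k + 1), g t else 0)
    {KA : ℕ → ℕ → ℕ → ℝ} {RA : ℕ → (ℕ → ℝ) → ℕ → ℝ}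
    (hRA : ∀ i v m, RA i v m = ∑ l ∈ range K, KA i m l * v (m + 1 + l))
    (hKA : ∀ i m l, KA i m l = KL i m l + KA (i + 1) m l) (hKAtop : ∀ m l, KA K m l = 0)
    {e ε : ℕ → ℝ} (he0 : ∀ m, 0 ≤ e m) (hea : ∀ m, e (m + 1) ≤ e m)
    (hεt : ∀ m, N < m → ε m = 0) (hεrec : ∀ m, ε m = e m - RA 1 ε m) : ∀ m, 0 ≤ ε m ∧ ε m ≤ e m := by
  rcases Nat.lt_or_ge 1 r with h1r | h1r
  · rcases le_or_gt 58 (a 1) with hold | hyoung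
    · exact flow_nonneg_tower10_old_second hmono hL hb hlo hdom hh hf hg hgF hr ha0 (fun _ => hold) haR haK hLa hKL hRA hKA hKAtop he0 hea hεt hεrec
    · exact flow_nonneg_young_second_tower10 hmono hL hb hlo hdom hh hf hg hgF (by omega) ha0 (by omega) haR haK hLa hKL hRA hKA hKAtop he0 hea
        hεt hεrec
  · exact flow_nonneg_tower10_old_second hmono hL hb hlo hdom hh hf hg hgF hr ha0 (fun h => absurd h (by omega)) haR haK hLa hKL hRA hKA hKAtop
      he0 hea hεt hεrec

/-! ## §2 Census corollaries -/

/-- **FOUR AGES AT RATIO TEN.**  Ages `1 ≤ k₁` (ANY), `10k₁ ≤ k₂`, `10k₂ ≤ k₃`, `10k₃ ≤ k₄ < K`, the profile vanishing off them: `0 ≤ ε ≤ e` at every pin, every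
horizon, every damping of the self-consistent class. [folklore] -/
theorem flow_nonneg_four_ages_ratio_ten
    (hmono : ∀ u v : ℕ → ℝ, SeqBox γ u → SeqBox γ v → (∀ j, u j ≤ v j) → B u ≤ B v)
    (hL : ∀ k, 0 ≤ L k) (hb : 0 < b) (hlo : ∀ u, SeqBox γ u → b ≤ B u) (hdom : ∀ u, SeqBox γ u → ∑ k ∈ range K, L k * u k ≤ B u)
    (hh : SeqBox γ h) (hf : MemFlow B gIR h) (hg : ∀ t, 0 < g t ∧ g t ≤ 1)
    (hgF : ∀ t, 1 ≤ g t * (1 + ∑ k ∈ range K, L k * h (t + k) ^ 3 / 2))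
    {k₁ k₂ k₃ k₄ : ℕ} (hk1 : 1 ≤ k₁) (hk2 : 10 * k₁ ≤ k₂) (hk3 : 10 * k₂ ≤ k₃) (hk4 : 10 * k₃ ≤ k₄) (hk4K : k₄ < K)
    (hL4 : ∀ j, j < K → j ≠ k₁ → j ≠ k₂ → j ≠ k₃ → j ≠ k₄ → L j = 0)
    {N : ℕ} {KL : ℕ → ℕ → ℕ → ℝ}
    (hKL : ∀ k n l, KL k n l = if 0 < k ∧ k < K ∧ l < k then L k * h (n + k) ^ 3 / 2 * ∏ t ∈ Ico (n + 1 + l) (n + k + 1), g t else 0)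
    {KA : ℕ → ℕ → ℕ → ℝ} {RA : ℕ → (ℕ → ℝ) → ℕ → ℝ}
    (hRA : ∀ i v m, RA i v m = ∑ l ∈ range K, KA i m l * v (m + 1 + l))
    (hKA : ∀ i m l, KA i m l = KL i m l + KA (i + 1) m l) (hKAtop : ∀ m l, KA K m l = 0)
    {e ε : ℕ → ℝ} (he0 : ∀ m, 0 ≤ e m) (hea : ∀ m, e (m + 1) ≤ e m)
    (hεt : ∀ m, N < m → ε m = 0) (hεrec : ∀ m, ε m = e m - RA 1 ε m) : ∀ m, 0 ≤ ε m ∧ ε m ≤ e m := by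
  refine flow_nonneg_ratio_ten hmono hL hb hlo hdom hh hf hg hgF (r := 4)
    (a := fun j => if j = 0 then k₁ else if j = 1 then k₂ else if j = 2 then k₃ else k₄) (by norm_num) (by simpa using hk1)
    (fun j hjr => ?_) (fun j hj => ?_) (fun l hl hla => hL4 l hl ?_ ?_ ?_ ?_) hKL hRA hKA hKAtop he0 hea hεt hεrec
  · have : j = 0 ∨ j = 1 ∨ j = 2 := by omega
    rcases this with rfl | rfl | rfl <;> simpa
  · have : j = 0 ∨ j = 1 ∨ j = 2 ∨ j = 3 := by omega
    rcases this with rfl | rfl | rfl | rfl <;> simp <;> omega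
  · simpa using hla 0 (by norm_num)
  · simpa using hla 1 (by norm_num)
  · simpa using hla 2 (by norm_num)
  · simpa using hla 3 (by norm_num)

/-- **FIVE AGES AT RATIO TEN.**  Ages `1 ≤ k₁` (ANY), `10k_i ≤ k_{i+1}` (`i = 1, …, 4`), `k₅ < K`, the profile vanishing off them: `0 ≤ ε ≤ e` at every pin. [folklore] -/
theorem flow_nonneg_five_ages_ratio_ten
    (hmono : ∀ u v : ℕ → ℝ, SeqBox γ u → SeqBox γ v → (∀ j, u j ≤ v j) → B u ≤ B v)
    (hL : ∀ k, 0 ≤ L k) (hb : 0 < b) (hlo : ∀ u, SeqBox γ u → b ≤ B u) (hdom : ∀ u, SeqBox γ u → ∑ k ∈ range K, L k * u k ≤ B u)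
    (hh : SeqBox γ h) (hf : MemFlow B gIR h) (hg : ∀ t, 0 < g t ∧ g t ≤ 1)
    (hgF : ∀ t, 1 ≤ g t * (1 + ∑ k ∈ range K, L k * h (t + k) ^ 3 / 2))
    {k₁ k₂ k₃ k₄ k₅ : ℕ} (hk1 : 1 ≤ k₁) (hk2 : 10 * k₁ ≤ k₂) (hk3 : 10 * k₂ ≤ k₃) (hk4 : 10 * k₃ ≤ k₄) (hk5 : 10 * k₄ ≤ k₅) (hk5K : k₅ < K)
    (hL5 : ∀ j, j < K → j ≠ k₁ → j ≠ k₂ → j ≠ k₃ → j ≠ k₄ → j ≠ k₅ → L j = 0)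
    {N : ℕ} {KL : ℕ → ℕ → ℕ → ℝ}
    (hKL : ∀ k n l, KL k n l = if 0 < k ∧ k < K ∧ l < k then L k * h (n + k) ^ 3 / 2 * ∏ t ∈ Ico (n + 1 + l) (n + k + 1), g t else 0)
    {KA : ℕ → ℕ → ℕ → ℝ} {RA : ℕ → (ℕ → ℝ) → ℕ → ℝ}
    (hRA : ∀ i v m, RA i v m = ∑ l ∈ range K, KA i m l * v (m + 1 + l))
    (hKA : ∀ i m l, KA i m l = KL i m l + KA (i + 1) m l) (hKAtop : ∀ m l, KA K m l = 0)
    {e ε : ℕ → ℝ} (he0 : ∀ m, 0 ≤ e m) (hea : ∀ m, e (m + 1) ≤ e m)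
    (hεt : ∀ m, N < m → ε m = 0) (hεrec : ∀ m, ε m = e m - RA 1 ε m) : ∀ m, 0 ≤ ε m ∧ ε m ≤ e m := by
  refine flow_nonneg_ratio_ten hmono hL hb hlo hdom hh hf hg hgF (r := 5)
    (a := fun j => if j = 0 then k₁ else if j = 1 then k₂ else if j = 2 then k₃ else if j = 3 then k₄ else k₅) (by norm_num) (by simpa using hk1)
    (fun j hjr => ?_) (fun j hj => ?_) (fun l hl hla => hL5 l hl ?_ ?_ ?_ ?_ ?_) hKL hRA hKA hKAtop he0 hea hεt hεrec
  · have : j = 0 ∨ j = 1 ∨ j = 2 ∨ j = 3 := by omega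
    rcases this with rfl | rfl | rfl | rfl <;> simpa
  · have : j = 0 ∨ j = 1 ∨ j = 2 ∨ j = 3 ∨ j = 4 := by omega
    rcases this with rfl | rfl | rfl | rfl | rfl <;> simp <;> omega
  · simpa using hla 0 (by norm_num)
  · simpa using hla 1 (by norm_num)
  · simpa using hla 2 (by norm_num)
  · simpa using hla 3 (by norm_num)
  · simpa using hla 4 (by norm_num)

end Summit.QuantumFields.BalabanUV.Beta.EriceRemainderEnclosureHistoryAutonomyComparisonAgeCompositionRatioTenThroughout

end
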